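import Summits.QuantumFields.YangMills.Theorems.ConvexGribovBodyNonSimplyConnectedLatticeGapOfGoodExteriorMixing
import Summits.QuantumFields.YangMills.Theorems.ConvexGribovBodyNonSimplyConnectedLatticeGapStubCruxOfMeanBoxInfluenceDecayHalfTorusNSC
import Summits.QuantumFields.YangMills.Theorems.ConvexGribovBodyNonSimplyConnectedLatticeGapStubHalfTorusLeafOfRareOfGoodMixing
import HarnessLib

/-!
# Crux `NonSimplyConnectedLatticeGap` (stmt-QuantumFields-16405), line `Sketch`: the hypothesis `¬ SimplyConnectedSpace G`
# is idle in the whole line — good-exterior weak mixing for ALL compact simple `G` gives the rank-0 target `UniformLatticeGap`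

The line `Sketch` (skeleton `Cruxes/NonSimplyConnectedLatticeGap/Lines/Sketch.lean` v15) reduces the crux to its one open stub
P2 `stub_goodExteriorMixing` (weak mixing on cubes `Λ_L = [−L,L]⁴ × univ` at every fixed large `β`, uniformly over GOOD exterior
data — no long chain of `a`-bad plaquettes in the shell `L < ‖x‖∞ ≤ 2L` — for compact simple `G` with `π₁(G) ≠ 0`), through
P1 `longBadChainsRare` (PROVED for every compact simple `G`, p141434), TR `stub_halfTorusLeaf_of_rare_of_goodMixing` (p134294) and
T‴ `stub_cruxOfMeanBoxInfluenceDecayHalfTorusNSC` (p134093): `nonSimplyConnectedLatticeGap_of_goodExteriorMixing` (p141966).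
Neither TR nor T‴ nor P1 reads `¬ SimplyConnectedSpace G`; this file records the fact in the kernel. Write P2⁎ for P2 with the
clause `¬ SimplyConnectedSpace G →` deleted (good-exterior weak mixing at large `β` for EVERY compact simple `G` and every
faithful unitary `r`) and A‴⁎ for the likewise un-restricted averaged half-torus leaf.

* `halfTorusLeaf_of_rare_of_goodMixing_all` — P1 ∧ P2⁎ ⇒ A‴⁎ (TR verbatim without the idle hypothesis);
* `uniformLatticeGap_of_meanBoxInfluenceDecayHalfTorus` — A‴⁎ ⇒ `ConvexGribovBody.UniformLatticeGap` (T‴'s core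
  `clustering_of_meanBoxInfluenceDecayHalfTorus_at`, rate `m/2`, `S₁ = 0`);
* `stub_uniformLatticeGap_of_goodExteriorMixingAll` — **P2⁎ ⇒ `UniformLatticeGap`, the route's rank-0 TARGET** (stmt-QuantumFields-8778),
  hence both of its halves (the simply-connected half and this crux);
* `goodExteriorMixing_of_all` — P2⁎ ⇒ P2 (restriction), and `nonSimplyConnectedLatticeGap_of_goodExteriorMixingAll` — P2⁎ ⇒ the crux.

Reading for the planner: the line contains no mechanism specific to `π₁(G) ≠ 0`; its open stub is the finite-volume, fixed-`β`
form of the weak-coupling lattice mass gap for all compact simple `G`. If P2 is promoted to an item, the `π₁`-free form P2⁎ is the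
one to file: a single item that closes the target `UniformLatticeGap` outright by `stub_uniformLatticeGap_of_goodExteriorMixingAll`.

References: H.-O. Georgii, *Gibbs Measures and Phase Transitions*, 2nd ed. (de Gruyter 2011), Thm. 4.17, §8.2 (DLR consistency,
quasilocality); F. Martinelli, LNM 1717 (1999), §2.3 (weak mixing ⇒ exponential clustering).
-/

set_option autoImplicit false

noncomputable section

open MeasureTheory
open Literature.Probability.LatticeModels
open Literature.MathematicalPhysics.QuantumLattice
open Literature.MathematicalPhysics.QuantumFieldTheory (GaugeConfig wilsonMeasure LatticeRep YMSpecies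
  IsCompactSimpleLieGroup)
open Summit.QuantumFields.YangMills.Cruxes.NonSimplyConnectedLatticeGap.Sketch (goodExterior
  stub_measurableSet_goodExterior)

namespace Summit.QuantumFields.YangMills.Theorems.NonSimplyConnectedLatticeGap

/-- **P1 ∧ P2⁎ ⇒ A‴⁎ — rarity of bad exterior data + weak mixing uniformly over good exterior data ⇒ the averaged half-torus
leaf, for EVERY compact simple `G`** (TR `stub_halfTorusLeaf_of_rare_of_goodMixing` with the idle clause `¬ SimplyConnectedSpace G`
deleted from hypothesis and conclusion; same proof: at `β ≥ max β₂ β₃`, `Good = goodExterior r.ρ a L`, `δ = |C_A| e^{−mL}`,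
`ε = |C₁| e^{−cL}`, the landed GOOD `stub_meanBoxInfluence_le_of_goodSet` gives `∫ |γ_{Λ_L}(A | Ũ) − μ_S(A)| dμ_S ≤ 2δ + 4‖A‖∞ ε`). -/
theorem halfTorusLeaf_of_rare_of_goodMixing_all : (∀ (G : Type) [Group G] [TopologicalSpace G] [IsTopologicalGroup G] [CompactSpace G] [MeasurableSpace G] [BorelSpace G], Literature.MathematicalPhysics.QuantumFieldTheory.IsCompactSimpleLieGroup G → ∀ r : Literature.MathematicalPhysics.QuantumFieldTheory.LatticeRep G, ∀ a : ℝ, 0 < a → ∃ β₃ : ℝ, ∀ β : ℝ, β₃ ≤ β → ∃ c : ℝ, 0 < c ∧ ∃ C : ℝ, ∀ (L S : ℕ), 2 * L + 1 ≤ S → ((Literature.MathematicalPhysics.QuantumFieldTheory.wilsonMeasure r.ρ β : MeasureTheory.Measure (Literature.MathematicalPhysics.QuantumFieldTheory.GaugeConfig 4 (2 * S + 1) G)) {V | Literature.MathematicalPhysics.QuantumLattice.torusLift (2 * S + 1) V ∉ Summit.QuantumFields.YangMills.Cruxes.NonSimplyConnectedLatticeGap.Sketch.goodExterior r.ρ a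 L}).toReal ≤ C * Real.exp (-(c * L))) → (∀ (G : Type) [Group G] [TopologicalSpace G] [IsTopologicalGroup G] [CompactSpace G] [MeasurableSpace G] [BorelSpace G], Literature.MathematicalPhysics.QuantumFieldTheory.IsCompactSimpleLieGroup G → ∀ r : Literature.MathematicalPhysics.QuantumFieldTheory.LatticeRep G, ∃ a : ℝ, 0 < a ∧ ∃ β₂ : ℝ, ∀ β : ℝ, β₂ ≤ β → ∃ m : ℝ, 0 < m ∧ ∀ A : Literature.MathematicalPhysics.QuantumFieldTheory.YMSpecies G, ∃ C : ℝ, ∀ L : ℕ, A.supp ⊆ ((Fintype.piFinset fun _ : Fin 4 => Finset.Icc (-((L : ℕ) : ℤ)) ((L : ℕ) : ℤ)) ×ˢ (Finset.univ : Finset (Fin 4))) → ∀ η ∈ Summit.QuantumFields.YangMills.Cruxes.NonSimplyConnectedLatticeGap.Sketch.goodExterior r.ρ a L, ∀ η' ∈ Summit.QuantumFields.YangMills.Cruxes.NonSimplyConnectedLatticeGap.Sketch.goodExterior r.ρ a L, |(∫ U, A.F U ∂(Literature.MathematicalPhysics.QuantumLattice.ymSpecification r.ρ β ((Fintype.piFinset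 fun _ : Fin 4 => Finset.Icc (-((L : ℕ) : ℤ)) ((L : ℕ) : ℤ)) ×ˢ (Finset.univ : Finset (Fin 4))) η)) - ∫ U, A.F U ∂(Literature.MathematicalPhysics.QuantumLattice.ymSpecification r.ρ β ((Fintype.piFinset fun _ : Fin 4 => Finset.Icc (-((L : ℕ) : ℤ)) ((L : ℕ) : ℤ)) ×ˢ (Finset.univ : Finset (Fin 4))) η')| ≤ C * Real.exp (-(m * L))) → ∀ (G : Type) [Group G] [TopologicalSpace G] [IsTopologicalGroup G] [CompactSpace G] [MeasurableSpace G] [BorelSpace G], Literature.MathematicalPhysics.QuantumFieldTheory.IsCompactSimpleLieGroup G → ∀ r : Literature.MathematicalPhysics.QuantumFieldTheory.LatticeRep G, ∃ β₂ : ℝ, ∀ β : ℝ, β₂ ≤ β → ∃ m : ℝ, 0 < m ∧ ∀ A : Literature.MathematicalPhysics.QuantumFieldTheory.YMSpecies G, ∃ C : ℝ, ∀ (L S : ℕ), A.supp ⊆ ((Fintype.piFinset fun _ : Fin 4 => Finset.Icc (-((L : ℕ) : ℤ)) ((L : ℕ) : ℤ)) ×ˢ (Finset.univ : Finset (Fin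 4))) → 2 * L + 1 ≤ S → ∫ V, |(∫ U, A.F U ∂(Literature.MathematicalPhysics.QuantumLattice.ymSpecification r.ρ β ((Fintype.piFinset fun _ : Fin 4 => Finset.Icc (-((L : ℕ) : ℤ)) ((L : ℕ) : ℤ)) ×ˢ (Finset.univ : Finset (Fin 4))) (Literature.MathematicalPhysics.QuantumLattice.torusLift (2 * S + 1) V))) - ∫ W, A.F (Literature.MathematicalPhysics.QuantumLattice.torusLift (2 * S + 1) W) ∂(Literature.MathematicalPhysics.QuantumFieldTheory.wilsonMeasure r.ρ β : MeasureTheory.Measure (Literature.MathematicalPhysics.QuantumFieldTheory.GaugeConfig 4 (2 * S + 1) G))| ∂(Literature.MathematicalPhysics.QuantumFieldTheory.wilsonMeasure r.ρ β : MeasureTheory.Measure (Literature.MathematicalPhysics.QuantumFieldTheory.GaugeConfig 4 (2 * S + 1) G)) ≤ C * Real.exp (-(m * L)) := by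
  intro hP1 hP2 G _ _ _ _ _ _ hG r
  obtain ⟨a, ha, β₂, hβ₂⟩ := hP2 G hG r
  obtain ⟨β₃, hβ₃⟩ := hP1 G hG r a ha
  refine ⟨max β₂ β₃, fun β hβ => ?_⟩
  obtain ⟨m, hm, hmix⟩ := hβ₂ β ((le_max_left _ _).trans hβ)
  obtain ⟨c, hc, C₁, hrare⟩ := hβ₃ β ((le_max_right _ _).trans hβ)
  refine ⟨min m c, lt_min hm hc, fun A => ?_⟩
  obtain ⟨C_A, hmixA⟩ := hmix A
  obtain ⟨CA, hCA⟩ := A.bounded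
  have hCA0 : 0 ≤ CA := (abs_nonneg _).trans (hCA fun _ => 1)
  haveI : T2Space G := (r.continuous.isClosedEmbedding r.injective).isEmbedding.t2Space
  haveI : SecondCountableTopology G :=
    (r.continuous.isClosedEmbedding r.injective).isEmbedding.secondCountableTopology
  refine ⟨2 * |C_A| + 4 * CA * |C₁|, fun L S hsupp h2 => ?_⟩
  have hδ0 : 0 ≤ |C_A| * Real.exp (-(m * L)) := by positivity
  -- (P2) at `A`, with the non-negative constant `|C_A|`
  have hvar : ∀ η ∈ goodExterior r.ρ a L, ∀ η' ∈ goodExterior r.ρ a L,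
      |(∫ U, A.F U ∂(ymSpecification r.ρ β ((Fintype.piFinset fun _ : Fin 4 =>
          Finset.Icc (-((L : ℕ) : ℤ)) ((L : ℕ) : ℤ)) ×ˢ (Finset.univ : Finset (Fin 4))) η)) -
        ∫ U, A.F U ∂(ymSpecification r.ρ β ((Fintype.piFinset fun _ : Fin 4 =>
          Finset.Icc (-((L : ℕ) : ℤ)) ((L : ℕ) : ℤ)) ×ˢ (Finset.univ : Finset (Fin 4))) η')| ≤
        |C_A| * Real.exp (-(m * L)) :=
    fun η hη η' hη' => (hmixA L hsupp η hη η' hη').trans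
      (mul_le_mul_of_nonneg_right (le_abs_self _) (Real.exp_nonneg _))
  -- (P1), with the non-negative constant `|C₁|`
  have hε : ((wilsonMeasure (d := 4) (L := 2 * S + 1) r.ρ β)
      {V | torusLift (2 * S + 1) V ∉ goodExterior r.ρ a L}).toReal ≤ |C₁| * Real.exp (-(c * L)) :=
    (hrare L S h2).trans (mul_le_mul_of_nonneg_right (le_abs_self _) (Real.exp_nonneg _))
  -- GOOD
  have key := stub_meanBoxInfluence_le_of_goodSet G r.N r.ρ r.continuous β A CA hCA L S hsupp (by omega)
    (goodExterior r.ρ a L) (stub_measurableSet_goodExterior G r.N r.ρ r.continuous a L) _ _ hδ0 hvar hε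
  exact key.trans (two_mul_add_four_mul_le_mul_exp_min (Nat.cast_nonneg L) (abs_nonneg _) (abs_nonneg _) hCA0)

/-- **A‴⁎ ⇒ `UniformLatticeGap` — averaged weak mixing on half-torus cubes at large `β`, for every compact simple `G`, gives the
rank-0 target** (T‴ without the idle clause; core `clustering_of_meanBoxInfluenceDecayHalfTorus_at`, rate `m/2`, `S₁ = 0`). -/
theorem uniformLatticeGap_of_meanBoxInfluenceDecayHalfTorus : (∀ (G : Type) [Group G] [TopologicalSpace G] [IsTopologicalGroup G] [CompactSpace G] [MeasurableSpace G] [BorelSpace G], Literature.MathematicalPhysics.QuantumFieldTheory.IsCompactSimpleLieGroup G → ∀ r : Literature.MathematicalPhysics.QuantumFieldTheory.LatticeRep G, ∃ β₂ : ℝ, ∀ β : ℝ, β₂ ≤ β → ∃ m : ℝ, 0 < m ∧ ∀ A : Literature.MathematicalPhysics.QuantumFieldTheory.YMSpecies G, ∃ C : ℝ, ∀ (L S : ℕ), A.supp ⊆ ((Fintype.piFinset fun _ : Fin 4 => Finset.Icc (-((L : ℕ) : ℤ)) ((L : ℕ) : ℤ)) ×ˢ (Finset.univ : Finset (Fin 4)))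 → 2 * L + 1 ≤ S → ∫ V, |(∫ U, A.F U ∂(Literature.MathematicalPhysics.QuantumLattice.ymSpecification r.ρ β ((Fintype.piFinset fun _ : Fin 4 => Finset.Icc (-((L : ℕ) : ℤ)) ((L : ℕ) : ℤ)) ×ˢ (Finset.univ : Finset (Fin 4))) (Literature.MathematicalPhysics.QuantumLattice.torusLift (2 * S + 1) V))) - ∫ W, A.F (Literature.MathematicalPhysics.QuantumLattice.torusLift (2 * S + 1) W) ∂(Literature.MathematicalPhysics.QuantumFieldTheory.wilsonMeasure r.ρ β : MeasureTheory.Measure (Literature.MathematicalPhysics.QuantumFieldTheory.GaugeConfig 4 (2 * S + 1) G))| ∂(Literature.MathematicalPhysics.QuantumFieldTheory.wilsonMeasure r.ρ β : MeasureTheory.Measure (Literature.MathematicalPhysics.QuantumFieldTheory.GaugeConfig 4 (2 * S + 1) G)) ≤ C * Real.exp (-(m * L))) → Summit.QuantumFields.YangMills.Theses.ConvexGribovBody.UniformLatticeGap := by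
  intro h G _ _ _ _ _ _ hG r
  obtain ⟨β₂, hβ₂⟩ := h G hG r
  refine ⟨β₂, fun β hβ => ?_⟩
  obtain ⟨m, hm, hAll⟩ := hβ₂ β hβ
  refine ⟨m / 2, half_pos hm, 0, fun A B => ?_⟩
  haveI : T2Space G := (r.continuous.isClosedEmbedding r.injective).isEmbedding.t2Space
  haveI : SecondCountableTopology G :=
    (r.continuous.isClosedEmbedding r.injective).isEmbedding.secondCountableTopology
  obtain ⟨C, hC⟩ := clustering_of_meanBoxInfluenceDecayHalfTorus_at r.ρ r.continuous β hm.le hAll A B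
  exact ⟨C, fun S n _ hn => hC S n hn⟩

/-- **P2⁎ ⇒ the rank-0 target `UniformLatticeGap`**: good-exterior weak mixing on cubes at large `β` for EVERY compact simple
`G` and every faithful unitary `r` (the open stub P2 of line `Sketch` with `¬ SimplyConnectedSpace G →` deleted) implies the
volume-uniform lattice mass gap at large `β` for every compact simple `G` — through P1 `longBadChainsRare` (proved),
`halfTorusLeaf_of_rare_of_goodMixing_all` and `uniformLatticeGap_of_meanBoxInfluenceDecayHalfTorus`. (Registered on the crux item as a
derived stub so that it lands `--supports`; it certifies that the line's reduction never uses `π₁(G) ≠ 0`.) -/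
theorem stub_uniformLatticeGap_of_goodExteriorMixingAll : (∀ (G : Type) [Group G] [TopologicalSpace G] [IsTopologicalGroup G] [CompactSpace G] [MeasurableSpace G] [BorelSpace G], Literature.MathematicalPhysics.QuantumFieldTheory.IsCompactSimpleLieGroup G → ∀ r : Literature.MathematicalPhysics.QuantumFieldTheory.LatticeRep G, ∃ a : ℝ, 0 < a ∧ ∃ β₂ : ℝ, ∀ β : ℝ, β₂ ≤ β → ∃ m : ℝ, 0 < m ∧ ∀ A : Literature.MathematicalPhysics.QuantumFieldTheory.YMSpecies G, ∃ C : ℝ, ∀ L : ℕ, A.supp ⊆ ((Fintype.piFinset fun _ : Fin 4 => Finset.Icc (-((L : ℕ) : ℤ)) ((L : ℕ) : ℤ)) ×ˢ (Finset.univ : Finset (Fin 4))) → ∀ η ∈ Summit.QuantumFields.YangMills.Cruxes.NonSimplyConnectedLatticeGap.Sketch.goodExterior r.ρ a L, ∀ η' ∈ Summit.QuantumFields.YangMills.Cruxes.NonSimplyConnectedLatticeGap.Sketch.goodExterior r.ρ a L, |(∫ U, A.F U ∂(Literature.MathematicalPhysics.QuantumLattice.ymSpecification r.ρ β ((Fintype.piFinset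 fun _ : Fin 4 => Finset.Icc (-((L : ℕ) : ℤ)) ((L : ℕ) : ℤ)) ×ˢ (Finset.univ : Finset (Fin 4))) η)) - ∫ U, A.F U ∂(Literature.MathematicalPhysics.QuantumLattice.ymSpecification r.ρ β ((Fintype.piFinset fun _ : Fin 4 => Finset.Icc (-((L : ℕ) : ℤ)) ((L : ℕ) : ℤ)) ×ˢ (Finset.univ : Finset (Fin 4))) η')| ≤ C * Real.exp (-(m * L))) → Summit.QuantumFields.YangMills.Theses.ConvexGribovBody.UniformLatticeGap :=
  fun hP2 => uniformLatticeGap_of_meanBoxInfluenceDecayHalfTorus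
    (halfTorusLeaf_of_rare_of_goodMixing_all longBadChainsRare hP2)

/-- P2⁎ ⇒ P2: the `π₁`-free form restricts to the registered stub `stub_goodExteriorMixing` (pure logic). -/
theorem goodExteriorMixing_of_all : (∀ (G : Type) [Group G] [TopologicalSpace G] [IsTopologicalGroup G] [CompactSpace G] [MeasurableSpace G] [BorelSpace G], Literature.MathematicalPhysics.QuantumFieldTheory.IsCompactSimpleLieGroup G → ∀ r : Literature.MathematicalPhysics.QuantumFieldTheory.LatticeRep G, ∃ a : ℝ, 0 < a ∧ ∃ β₂ : ℝ, ∀ β : ℝ, β₂ ≤ β → ∃ m : ℝ, 0 < m ∧ ∀ A : Literature.MathematicalPhysics.QuantumFieldTheory.YMSpecies G, ∃ C : ℝ, ∀ L : ℕ, A.supp ⊆ ((Fintype.piFinset fun _ : Fin 4 => Finset.Icc (-((L : ℕ) : ℤ)) ((L : ℕ) : ℤ)) ×ˢ (Finset.univ : Finset (Fin 4))) → ∀ η ∈ Summit.QuantumFields.YangMills.Cruxes.NonSimplyConnectedLatticeGap.Sketch.goodExterior r.ρ a L, ∀ η' ∈ Summit.QuantumFields.YangMills.Cruxes.NonSimplyConnectedLatticeGap.Sketch.goodExterior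 r.ρ a L, |(∫ U, A.F U ∂(Literature.MathematicalPhysics.QuantumLattice.ymSpecification r.ρ β ((Fintype.piFinset fun _ : Fin 4 => Finset.Icc (-((L : ℕ) : ℤ)) ((L : ℕ) : ℤ)) ×ˢ (Finset.univ : Finset (Fin 4))) η)) - ∫ U, A.F U ∂(Literature.MathematicalPhysics.QuantumLattice.ymSpecification r.ρ β ((Fintype.piFinset fun _ : Fin 4 => Finset.Icc (-((L : ℕ) : ℤ)) ((L : ℕ) : ℤ)) ×ˢ (Finset.univ : Finset (Fin 4))) η')| ≤ C * Real.exp (-(m * L))) → (∀ (G : Type) [Group G] [TopologicalSpace G] [IsTopologicalGroup G] [CompactSpace G] [MeasurableSpace G] [BorelSpace G], Literature.MathematicalPhysics.QuantumFieldTheory.IsCompactSimpleLieGroup G → ¬ SimplyConnectedSpace G → ∀ r : Literature.MathematicalPhysics.QuantumFieldTheory.LatticeRep G, ∃ a : ℝ, 0 < a ∧ ∃ β₂ : ℝ, ∀ β : ℝ, β₂ ≤ β → ∃ m : ℝ, 0 < m ∧ ∀ A : Literature.MathematicalPhysics.QuantumFieldTheory.YMSpecies G, ∃ C : ℝ, ∀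 L : ℕ, A.supp ⊆ ((Fintype.piFinset fun _ : Fin 4 => Finset.Icc (-((L : ℕ) : ℤ)) ((L : ℕ) : ℤ)) ×ˢ (Finset.univ : Finset (Fin 4))) → ∀ η ∈ Summit.QuantumFields.YangMills.Cruxes.NonSimplyConnectedLatticeGap.Sketch.goodExterior r.ρ a L, ∀ η' ∈ Summit.QuantumFields.YangMills.Cruxes.NonSimplyConnectedLatticeGap.Sketch.goodExterior r.ρ a L, |(∫ U, A.F U ∂(Literature.MathematicalPhysics.QuantumLattice.ymSpecification r.ρ β ((Fintype.piFinset fun _ : Fin 4 => Finset.Icc (-((L : ℕ) : ℤ)) ((L : ℕ) : ℤ)) ×ˢ (Finset.univ : Finset (Fin 4))) η)) - ∫ U, A.F U ∂(Literature.MathematicalPhysics.QuantumLattice.ymSpecification r.ρ β ((Fintype.piFinset fun _ : Fin 4 => Finset.Icc (-((L : ℕ) : ℤ)) ((L : ℕ) : ℤ)) ×ˢ (Finset.univ : Finset (Fin 4))) η')| ≤ C * Real.exp (-(m * L))) :=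
  fun h G _ _ _ _ _ _ hG _ r => h G hG r

/-- **P2⁎ ⇒ the crux `NonSimplyConnectedLatticeGap`** (the landed reduction `nonSimplyConnectedLatticeGap_of_goodExteriorMixing`, p141966,
after the restriction `goodExteriorMixing_of_all`; equally the `π₁(G) ≠ 0` instance of `stub_uniformLatticeGap_of_goodExteriorMixingAll`). -/
theorem nonSimplyConnectedLatticeGap_of_goodExteriorMixingAll : (∀ (G : Type) [Group G] [TopologicalSpace G] [IsTopologicalGroup G] [CompactSpace G] [MeasurableSpace G] [BorelSpace G], Literature.MathematicalPhysics.QuantumFieldTheory.IsCompactSimpleLieGroup G → ∀ r : Literature.MathematicalPhysics.QuantumFieldTheory.LatticeRep G, ∃ a : ℝ, 0 < a ∧ ∃ β₂ : ℝ, ∀ β : ℝ, β₂ ≤ β → ∃ m : ℝ, 0 < m ∧ ∀ A : Literature.MathematicalPhysics.QuantumFieldTheory.YMSpecies G, ∃ C : ℝ, ∀ L : ℕ, A.supp ⊆ ((Fintype.piFinset fun _ : Fin 4 => Finset.Icc (-((L : ℕ) : ℤ)) ((L : ℕ) : ℤ)) ×ˢ (Finset.univ : Finset (Fin 4))) → ∀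 η ∈ Summit.QuantumFields.YangMills.Cruxes.NonSimplyConnectedLatticeGap.Sketch.goodExterior r.ρ a L, ∀ η' ∈ Summit.QuantumFields.YangMills.Cruxes.NonSimplyConnectedLatticeGap.Sketch.goodExterior r.ρ a L, |(∫ U, A.F U ∂(Literature.MathematicalPhysics.QuantumLattice.ymSpecification r.ρ β ((Fintype.piFinset fun _ : Fin 4 => Finset.Icc (-((L : ℕ) : ℤ)) ((L : ℕ) : ℤ)) ×ˢ (Finset.univ : Finset (Fin 4))) η)) - ∫ U, A.F U ∂(Literature.MathematicalPhysics.QuantumLattice.ymSpecification r.ρ β ((Fintype.piFinset fun _ : Fin 4 => Finset.Icc (-((L : ℕ) : ℤ)) ((L : ℕ) : ℤ)) ×ˢ (Finset.univ : Finset (Fin 4))) η')| ≤ C * Real.exp (-(m * L))) → Summit.QuantumFields.YangMills.Theses.ConvexGribovBody.NonSimplyConnectedLatticeGap :=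
  fun hP2 => nonSimplyConnectedLatticeGap_of_goodExteriorMixing (goodExteriorMixing_of_all hP2)

end Summit.QuantumFields.YangMills.Theorems.NonSimplyConnectedLatticeGap

end
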